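import Summits.ResolutionOfSingularities.ResolutionOfSingularities.Theses.FrobeniusLadder
import Summits.ResolutionOfSingularities.ResolutionOfSingularities.Theorems.FrobeniusLadderRegularStalksClimb
import Literature.RingTheory.TightClosure.TightClosure
import Literature.RingTheory.TightClosure.RegularTightlyClosed

/-!
# Disproof of `FRationalModification` (crux stmt-ResolutionOfSingularities-15316) — findings

Standing-adversary work file (cdisprove, gen 1 / cycle 1, v1.2 2026-08-16,
refuter-cdisprove-stmt-ResolutionOfSingularities-15316-0). Prose only in docstrings; every `theorem`
below is sorry-free (`lean check` rc 0, axioms `propext / Classical.choice / Quot.sound`). Imports are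
explicit: the route file, the tree's proof of the support item `RegularStalksClimb`
(`Theorems/FrobeniusLadderRegularStalksClimb.lean`) and the tight-closure vocabulary
(`Literature/RingTheory/TightClosure/*`).

LANDED (importable; Theorems files carry no `def`s — the predicates below are written out inline there):
§1–§2 as `Summit.ResolutionOfSingularities.ResolutionOfSingularities.Theorems.FRationalModification.Negative.LoadBearing`
(p129088 ACCEPTED: `rungTwo_of_isRegularLocalRing`, `rungThree_of_isRegularLocalRing`,
`rungTwoModel_of_hasResolution`, `rungThreeModel_of_hasResolution`, `frobeniusLadder_iff_summit`,
`not_summit_of_not_fRationalModification`, `fRationalModification_without_antecedent_of_summit`,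
`not_rungTwo_zero`, `nonempty_of_isBirational`, `fRationalModification_at_zero`,
`fRationalModification_without_prime_iff`); §3 in GENERAL form as `….Negative.RungTwoNotRungThreeRing`
(p129449 ACCEPTED: the rings `R = K + X·L⟦X⟧` for any field `L ⊇ K`, hypothesis `hR : f ∈ R ↔ f(0) ∈ K`;
local, `char L`, Noetherian if `[L:K] < ∞`, `dim R = 1`, `(X)` a parameter ideal, prime field
Frobenius-saturated, `𝔽_{p²} ≠ 𝔽_p`) and `….Negative.RungTwoNotRungThree` (p129610 ACCEPTED:
`rungTwo_of_mem_iff` — rung 2 whenever `K` is Frobenius-saturated in `L`; `not_rungThree_of_mem_iff` —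
rung 3 fails whenever `K ≠ L`; `exists_rungTwo_not_rungThree`, `localRungClimb_false_at`,
`localRungClimb_false`). This work file keeps the concrete `W_p = 𝔽_p + X·𝔽_{p²}⟦X⟧` version.

THE CRUX (route FrobeniusLadder, rank 3, transport-closed form). For every prime `p`, field `k` of
characteristic `p` and reduced separated finite-type `f : X → Spec k`:
`HasRungTwoModel p X → HasRungThreeModel p X` (§0), where a rung-2 model is a proper birational
`X₁ → X` with every stalk a domain in which every system of parameters is a weakly regular sequence
generating a FROBENIUS-CLOSED ideal (locally integral + CM + F-injective), and a rung-3 model is a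
proper birational `X₂ → X` with every stalk a domain in which every s.o.p. ideal is TIGHTLY CLOSED
(inline form `c ≠ 0 ∧ (∀ e, c·y^(p^e) ∈ (s)^[p^e]) ⇒ y ∈ (s)`; F-rational). `crux_iff` records that
the route decl is literally `∀ p prime, CruxAt p`.

## Findings (cycle 1)

* §1 SUMMIT SHADOW — WHY IT RESISTS. Regular local rings of characteristic `p` are rung-2 AND rung-3
  (`rungTwoAt_of_isRegularLocalRing`, `rungThreeAt_of_isRegularLocalRing`: the support item
  `RegularStalksClimb` is PROVED in tree — Matsumura 17.4 + Hochster–Huneke 4.4 via Kunz), and every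
  stalk of a `k`-scheme has characteristic `p` (`charP_stalk`); hence a resolution of singularities is
  a model of every rung (`hasRungTwoModel_of_hasResolution`, `hasRungThreeModel_of_hasResolution`), the
  summit implies the crux EVEN WITH ITS ANTECEDENT DROPPED (`cruxWithoutAntecedent_of_summit`,
  `crux_of_summit`), and the whole ladder is EQUIVALENT to the summit (`ladder_iff_summit`; `closes` is
  the converse). So `¬crux → ¬summit` (`not_summit_of_not_crux`): a kill of this crux at any prime is a
  dimension-≥ 4 counterexample to resolution of singularities in characteristic `p` — none is in print,
  and no cheap attack below produces one. The antecedent (rung-2 model) is a LINE DEVICE (input of the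
  Kawasaki-style induction), logically unnecessary: provers may prove `CruxWithoutAntecedent`.
* §2 LOAD-BEARING HYPOTHESES, as theorems.
  - `p.Prime` is DECORATION: `CruxWithoutPrime ↔ crux` (`cruxWithoutPrime_iff`). A field has
    characteristic `0` or a prime, and THE `p = 0` CONJUNCT HOLDS (`cruxAt_zero`): at exponent `0` the
    Frobenius-closure clause degenerates (`e = 1`: `y ^ 0 ^ 1 = 1 ∈ span {1} = (s)^[0]`), so NO nonempty
    scheme has a rung-2 model (`not_rungTwoAt_zero`, using existence of a s.o.p. in a Noetherian local
    ring, `exists_isSystemOfParameters`, and `nonempty_of_isBirational`), and `X = ∅` is its own model.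
  - the ANTECEDENT dropped ⇒ still implied by the summit (§1): not refutable short of `¬summit`.
  - `IsReduced X` dropped ⇒ still implied by the summit (paper, not formalised — `X_red` is not in
    Mathlib): a rung-2 model is reduced, so its existence forces `X` generically reduced, and then
    `X̃ → X_red → X` (resolution of `X_red` composed with the closed immersion, an isomorphism over the
    dense reduced open) is a rung-3 model; for generically non-reduced `X` the implication is vacuous.
  - `IsSeparated f` / `LocallyOfFiniteType f` / `QuasiCompact f` dropped ⇒ the antecedent still forces
    `X'` (hence a dense open of `X`) to be "locally Noetherian-like" only through `IsProper π`; no cheap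
    witness: any counterexample needs a scheme NONE of whose proper birational models is F-rational,
    i.e. again a non-resolvable scheme. Not load-bearing for a refuter.
* §3 THE NATURAL STRENGTHENING "X₂ := X₁" IS FALSE (`localRungClimb_false`, at every prime:
  `exists_rungTwoAt_not_rungThreeAt`, `localRungClimb_false_at`). Witness `W_p = 𝔽_p + X·𝔽_{p²}⟦X⟧`
  (`Wit p`, a subring of `𝔽_{p²}⟦X⟧` cut out by "constant coefficient in `𝔽_p`"): a Noetherian
  (`module_finite_powerSeries`: `𝔽_{p²}⟦X⟧` is finite over `𝔽_p⟦X⟧`) local domain of characteristic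
  `p` and dimension one (`ringKrullDim_wit`, via `𝔪 ⊆ rad (a)` for all `a ≠ 0`,
  `maximalIdeal_le_radical`) that IS rung-2 (`rungTwoAt_wit`: `(a)` Frobenius closed because
  `y^q = r a^q ⇒ a ∣ y` in the DVR `𝔽_{p²}⟦X⟧` and the cofactor `b` has `b^q ∈ W_p`, so `b(0)^q ∈ 𝔽_p`,
  so `b(0) ∈ 𝔽_p` — the prime field is Frobenius-saturated, `mem_primeRange_of_pow_mem`) and is NOT
  rung-3 (`not_rungThreeAt_wit`: `ωX ∉ (X)` for `ω ∈ 𝔽_{p²} ∖ 𝔽_p`, yet `X·(ωX)^q = (ω^q X)·X^q ∈ (X^q)`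
  for all `q`). Geometrically (`p = 3`): the completed local ring of the integral plane curve
  `x² + y² = 0` over `𝔽₃` at the origin, an F-pure (Fedder: `(x²+y²)² ∉ (x³,y³)`) non-normal point that
  becomes a node over `𝔽₉`. READING FOR THE PROVER: rung 2 does not even imply NORMALITY; the
  F-rational modification must move (at least normalise) already in dimension one, where normalisation
  is exactly what it is; in the isolated-singularity layer-2 form (`IsolatedFRatBlowup`) the budget
  "colength of `τ(ω)`" must therefore also pay for non-normal F-injective points.
* §4 (planned, cycle 2 if granted) `W_p` is not integrally closed (Lean), the `∃ e`-variant of the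
  tight-closure clause is trivially false (so the inline `∀ e` is essential), F-pure normal non-F-rational
  surface points (Fermat cubic cone, `p ≡ 1 mod 3`: `z² ∈ (x,y)^* ∖ (x,y)` with `c = xy`) show the
  modification is not FINITE in dimension two — paper only (needs F-purity of the cone for all s.o.p.).
* Targets: none (payload `stuck_stubs = []`; no line picked for this crux yet).

BARRIER CATALOGUE (`Literature/Barriers/ResolutionOfSingularities/`) versus THIS crux:
`DimensionFourFrontier` applies as state of knowledge only (nothing above CM models is known in
dim ≥ 4; no falsity); `KangarooShadeIncrease`, `hauserPerlega…`, `Narasimhan…`, `hironakaQuadric…`,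
`DirectrixSmallCharacteristic`, `ResidualOrderUnbounded*` are failures of regular-centre / maximal
contact STRATEGIES — the crux has no centres and no invariant, they do not bite an existence statement;
`InseparableBaseChange*`, `RegularNotGeometricallyRegular`, `FrobeniusTwistResolution` concern base
change / universal homeomorphisms — not met (all `k` at once, absolute properties of local rings);
`QuasiExcellenceNecessary*` bites only beyond finite type; `LocalMonomializationFails*` is about
morphisms; `AbsoluteIntegralClosureNoResolution` (Literature) is non-Noetherian. `ledger negatives
--problem ResolutionOfSingularities`: nothing on F-singularities.

WHY IT RESISTS (one paragraph). The crux is an implication between two EXISTENCE statements of proper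
birational models, both of which are consequences of the resolution conjecture (regular ⇒ F-rational ⇒
F-injective-CM, all proved in tree), over exactly the summit's class of schemes; its negation at a prime
`p` says "some variety has a CM F-injective model but NO F-rational model", in particular no resolution
— an explicit counterexample to resolution of singularities in characteristic `p` (necessarily of
dimension ≥ 4, Cossart–Piltant). Junk escapes are closed: `IsBirational` pins nonempty models of
nonempty schemes (§2), the inline tight-closure clause is the printed one for domains
(`isFRational_iff_of_isDomain`), `p = 0` and non-fields cannot occur. What CAN be said negatively is
about PROOF SHAPES, and §3 says it: the identity / any non-normalising modification fails, at every
prime, already for curves.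
-/

noncomputable section

-- single-problem summit: the doubled namespace component `ResolutionOfSingularities` is forced
set_option linter.dupNamespace false

namespace Summit.ResolutionOfSingularities.ResolutionOfSingularities.Cruxes.FRationalModification.Disproof

open CategoryTheory AlgebraicGeometry IsLocalRing
open Literature.AlgebraicGeometry.Resolution Literature.RingTheory.TightClosure
open Summit.ResolutionOfSingularities.ResolutionOfSingularities.Theses.FrobeniusLadder

/-! ## §0 The stalk predicates and the model predicates (verbatim sub-formulas of the crux) -/

/-- RUNG-2 STALK PREDICATE (verbatim from the antecedent of the crux): `R` is a domain and every
system of parameters `s` (`d = dim R` elements, `rad (s)` maximal) is a weakly regular sequence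
generating a Frobenius-closed ideal. [folklore] -/
def RungTwoAt (p : ℕ) (R : Type) [CommRing R] : Prop :=
  IsDomain R ∧ ∀ d : ℕ, ringKrullDim R = d → ∀ s : Fin d → R,
    (Ideal.span (Set.range s)).radical.IsMaximal →
      RingTheory.Sequence.IsWeaklyRegular R (List.ofFn s) ∧
        ∀ y : R, (∃ e : ℕ, y ^ p ^ e ∈ Ideal.span ((fun z : R => z ^ p ^ e) ''
          (Ideal.span (Set.range s) : Set R))) → y ∈ Ideal.span (Set.range s)

/-- RUNG-3 STALK PREDICATE (verbatim from the conclusion of the crux): `R` is a domain and every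
ideal generated by a system of parameters is tightly closed, in the inline "all `e`, any `c ≠ 0`"
form. [folklore] -/
def RungThreeAt (p : ℕ) (R : Type) [CommRing R] : Prop :=
  IsDomain R ∧ ∀ d : ℕ, ringKrullDim R = d → ∀ s : Fin d → R,
    (Ideal.span (Set.range s)).radical.IsMaximal → ∀ y c : R, c ≠ 0 →
      (∀ e : ℕ, c * y ^ p ^ e ∈ Ideal.span ((fun z : R => z ^ p ^ e) ''
        (Ideal.span (Set.range s) : Set R))) → y ∈ Ideal.span (Set.range s)

/-- `X` has a proper birational model all of whose stalks are rung-2 (the crux's antecedent).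
[folklore] -/
def HasRungTwoModel (p : ℕ) (X : Scheme.{0}) : Prop :=
  ∃ (X' : Scheme.{0}) (π : X' ⟶ X), IsProper π ∧ IsBirational π ∧
    ∀ x : X', RungTwoAt p (X'.presheaf.stalk x)

/-- `X` has a proper birational model all of whose stalks are rung-3 (the crux's conclusion).
[folklore] -/
def HasRungThreeModel (p : ℕ) (X : Scheme.{0}) : Prop :=
  ∃ (X' : Scheme.{0}) (π : X' ⟶ X), IsProper π ∧ IsBirational π ∧
    ∀ x : X', RungThreeAt p (X'.presheaf.stalk x)

/-- The crux body at ONE exponent `p` (no primality assumed). [folklore] -/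
def CruxAt (p : ℕ) : Prop :=
  ∀ (k : Type) [Field k] [CharP k p] (X : Scheme.{0}) (f : X ⟶ Spec (.of k)),
    IsSeparated f → LocallyOfFiniteType f → QuasiCompact f → IsReduced X →
      HasRungTwoModel p X → HasRungThreeModel p X

/-- The crux is literally `∀ p prime, CruxAt p`. [folklore] -/
theorem crux_iff : FRationalModification ↔ ∀ p : ℕ, p.Prime → CruxAt p := Iff.rfl

/-- The sibling crux `FInjectiveMacaulayfication` (rank 2) is literally "every reduced separated
finite-type `X/k` has a rung-2 model". [folklore] -/
theorem fInjectiveMacaulayfication_iff :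
    FInjectiveMacaulayfication ↔ ∀ p : ℕ, p.Prime → ∀ (k : Type) [Field k] [CharP k p]
      (X : Scheme.{0}) (f : X ⟶ Spec (.of k)), IsSeparated f → LocallyOfFiniteType f →
        QuasiCompact f → IsReduced X → HasRungTwoModel p X := Iff.rfl

/-- The sibling crux `FRationalResolution` (rank 4) is literally "a rung-3 model gives a
resolution". [folklore] -/
theorem fRationalResolution_iff :
    FRationalResolution ↔ ∀ p : ℕ, p.Prime → ∀ (k : Type) [Field k] [CharP k p]
      (X : Scheme.{0}) (f : X ⟶ Spec (.of k)), IsSeparated f → LocallyOfFiniteType f →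
        QuasiCompact f → IsReduced X → HasRungThreeModel p X → Scheme.HasResolution X := Iff.rfl

/-! ## §1 Summit shadow: regular stalks are rung-2 and rung-3, so a resolution is a model of
every rung -/

/-- Every stalk of a `k`-scheme has the characteristic of `k` (it receives the field `k`).
[folklore] -/
theorem charP_stalk {p : ℕ} {k : Type} [Field k] [CharP k p] {Y : Scheme.{0}}
    (g : Y ⟶ Spec (.of k)) (y : Y) : CharP (Y.presheaf.stalk y) p := by
  let φ : k →+* Y.presheaf.stalk y :=
    (Y.presheaf.germ ⊤ y trivial).hom.comp (g.appTop.hom.comp (Scheme.ΓSpecIso (.of k)).inv.hom)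
  exact charP_of_injective_ringHom φ.injective p

/-- A regular local ring of prime characteristic `p` is rung-3 (`RegularStalksClimb`, proved in
tree: Hochster–Huneke, every ideal of a regular local ring is tightly closed). [folklore] -/
theorem rungThreeAt_of_isRegularLocalRing {p : ℕ} (hp : p.Prime) (R : Type) [CommRing R]
    [CharP R p] (hR : IsRegularLocalRing R) : RungThreeAt p R := by
  haveI := hR
  haveI : IsDomain R := isDomain_of_isRegularLocalRing R
  exact ⟨inferInstance, fun d hd s hs => (Theorems.RegularStalksClimb_proof p hp R hR d hd s hs).2⟩

/-- A regular local ring of prime characteristic `p` is rung-2 (s.o.p. = regular sequence; every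
ideal Frobenius closed). [folklore] -/
theorem rungTwoAt_of_isRegularLocalRing {p : ℕ} (hp : p.Prime) (R : Type) [CommRing R]
    [CharP R p] (hR : IsRegularLocalRing R) : RungTwoAt p R := by
  haveI := hR
  haveI : Fact p.Prime := ⟨hp⟩
  haveI : IsDomain R := isDomain_of_isRegularLocalRing R
  refine ⟨inferInstance, fun d hd s hs => ⟨(Theorems.RegularStalksClimb_proof p hp R hR d hd s hs).1, ?_⟩⟩
  exact (isFrobeniusClosed_iff p).mp (isFrobeniusClosed_of_isRegularLocalRing p _)

/-- A resolution of singularities of a `k`-scheme (`char k = p` prime) is a rung-3 model.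
[folklore] -/
theorem hasRungThreeModel_of_hasResolution {p : ℕ} (hp : p.Prime) {k : Type} [Field k]
    [CharP k p] {X : Scheme.{0}} (f : X ⟶ Spec (.of k)) (h : Scheme.HasResolution X) :
    HasRungThreeModel p X := by
  obtain ⟨X', π, hπ⟩ := h
  refine ⟨X', π, hπ.isProper, hπ.isBirational, fun x => ?_⟩
  haveI := charP_stalk (π ≫ f) x
  exact rungThreeAt_of_isRegularLocalRing hp _ (hπ.isRegular x)

/-- A resolution of singularities of a `k`-scheme (`char k = p` prime) is a rung-2 model.
[folklore] -/
theorem hasRungTwoModel_of_hasResolution {p : ℕ} (hp : p.Prime) {k : Type} [Field k]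
    [CharP k p] {X : Scheme.{0}} (f : X ⟶ Spec (.of k)) (h : Scheme.HasResolution X) :
    HasRungTwoModel p X := by
  obtain ⟨X', π, hπ⟩ := h
  refine ⟨X', π, hπ.isProper, hπ.isBirational, fun x => ?_⟩
  haveI := charP_stalk (π ≫ f) x
  exact rungTwoAt_of_isRegularLocalRing hp _ (hπ.isRegular x)

/-- The crux with its ANTECEDENT DROPPED: every reduced separated finite-type `X/k` has a rung-3
(F-rational) model. [folklore] -/
def CruxWithoutAntecedent : Prop :=
  ∀ p : ℕ, p.Prime → ∀ (k : Type) [Field k] [CharP k p] (X : Scheme.{0}) (f : X ⟶ Spec (.of k)),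
    IsSeparated f → LocallyOfFiniteType f → QuasiCompact f → IsReduced X → HasRungThreeModel p X

/-- Dropping the antecedent only strengthens the crux. [folklore] -/
theorem crux_of_cruxWithoutAntecedent (h : CruxWithoutAntecedent) : FRationalModification :=
  fun p hp k _ _ X f hs hl hq hr _ => h p hp k X f hs hl hq hr

/-- SUMMIT SHADOW: the summit implies the crux even with its antecedent dropped. [folklore] -/
theorem cruxWithoutAntecedent_of_summit (h : _root_.ResolutionOfSingularities) :
    CruxWithoutAntecedent := by
  intro p hp k _ _ X f hs hl hq hr
  exact hasRungThreeModel_of_hasResolution hp f (h p hp k X f hs hl hq hr)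

/-- SUMMIT SHADOW: the summit implies the crux. [folklore] -/
theorem crux_of_summit (h : _root_.ResolutionOfSingularities) : FRationalModification :=
  crux_of_cruxWithoutAntecedent (cruxWithoutAntecedent_of_summit h)

/-- SUMMIT SHADOW for the whole ladder: the summit implies each of the three cruxes, so the
route's conjunction is EQUIVALENT to the summit (faithfulness; `closes` is the converse).
[folklore] -/
theorem ladder_iff_summit :
    (FInjectiveMacaulayfication ∧ FRationalModification ∧ FRationalResolution) ↔
      _root_.ResolutionOfSingularities := by
  refine ⟨fun h => closes h.1 h.2.1 h.2.2, fun h => ⟨?_, crux_of_summit h, ?_⟩⟩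
  · intro p hp k _ _ X f hs hl hq hr
    exact hasRungTwoModel_of_hasResolution hp f (h p hp k X f hs hl hq hr)
  · intro p hp k _ _ X f hs hl hq hr _
    exact h p hp k X f hs hl hq hr

/-- Consequently a refutation of the crux is a refutation of the summit. [folklore] -/
theorem not_summit_of_not_crux (h : ¬ FRationalModification) : ¬ _root_.ResolutionOfSingularities :=
  fun hs => h (crux_of_summit hs)

/-! ## §2 Load-bearing hypotheses -/

/-- At exponent `p = 0` the rung-2 predicate FAILS for every Noetherian local ring: with `e = 1`
one has `y ^ 0 ^ 1 = 1` and `span ((fun z => z ^ 0 ^ 1) '' I) = span {1} = ⊤`, so Frobenius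
closedness of a parameter ideal `I` (which exists, Krull) would force `I = ⊤`. [folklore] -/
theorem not_rungTwoAt_zero (R : Type) [CommRing R] [IsLocalRing R] [IsNoetherianRing R] :
    ¬ RungTwoAt 0 R := by
  rintro ⟨_, h⟩
  obtain ⟨t, -, hcard⟩ := Ideal.exists_finset_card_eq_height_of_isNoetherianRing (maximalIdeal R)
  have hd : ringKrullDim R = (t.card : ℕ) := by
    rw [← maximalIdeal_height_eq_ringKrullDim, ← hcard]
    rfl
  obtain ⟨s, hs⟩ := exists_isSystemOfParameters hd
  obtain ⟨-, hmax⟩ := isSystemOfParameters_iff.mp hs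
  set I : Ideal R := Ideal.span (Set.range s) with hI
  have himg : (fun z : R => z ^ 0 ^ 1) '' (I : Set R) = {1} := by
    ext z
    simp only [pow_one, pow_zero, Set.mem_image, SetLike.mem_coe, Set.mem_singleton_iff]
    exact ⟨fun ⟨_, _, h⟩ => h.symm, fun h => ⟨0, I.zero_mem, h.symm⟩⟩
  have h1 : (1 : R) ∈ I := (h t.card hd s hmax).2 1 ⟨1, by
    rw [himg, Ideal.span_singleton_one]; exact Submodule.mem_top⟩
  exact hmax.ne_top ((Ideal.radical_eq_top).mpr ((Ideal.eq_top_iff_one I).mpr h1))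

/-- A birational morphism onto a nonempty scheme has nonempty source. [folklore] -/
theorem nonempty_of_isBirational {X' X : Scheme.{0}} (π : X' ⟶ X) (h : IsBirational π)
    [Nonempty X] : Nonempty X' := by
  obtain ⟨U, hU, -, hiso⟩ := h
  obtain ⟨u, hu⟩ := hU.nonempty
  let y : ↥(π ⁻¹ᵁ U) := (Scheme.homeoOfIso (asIso (π ∣_ U))).symm ⟨u, hu⟩
  exact ⟨y.1⟩

/-- THE `p = 0` CONJUNCT OF THE CRUX HOLDS (vacuously off `X = ∅`): over a field of characteristic
`0` a nonempty `X` has no rung-2 model at exponent `0` (`not_rungTwoAt_zero` at any stalk of the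
model), and `X = ∅` is its own rung-3 model. [folklore] -/
theorem cruxAt_zero : CruxAt 0 := by
  intro k _ _ X f _ _ _ _ hH
  obtain ⟨X', π, hπ, hbir, hst⟩ := hH
  rcases isEmpty_or_nonempty X with hX | hX
  · refine ⟨X, 𝟙 X, inferInstance, ⟨⊤, by simp, by simp, inferInstance⟩, fun x => (hX.false x).elim⟩
  · exfalso
    obtain ⟨x'⟩ := nonempty_of_isBirational π hbir
    haveI := hπ
    haveI : IsLocallyNoetherian X := LocallyOfFiniteType.isLocallyNoetherian f
    haveI : IsLocallyNoetherian X' := LocallyOfFiniteType.isLocallyNoetherian π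
    exact not_rungTwoAt_zero (X'.presheaf.stalk x') (hst x')

/-- The crux with `p.Prime` DROPPED. [folklore] -/
def CruxWithoutPrime : Prop := ∀ p : ℕ, CruxAt p

/-- `p.Prime` IS DECORATION: a field has characteristic `0` or a prime, and the `p = 0` conjunct
holds (`cruxAt_zero`). [folklore] -/
theorem cruxWithoutPrime_iff : CruxWithoutPrime ↔ FRationalModification := by
  refine ⟨fun h p _ => h p, fun h p k _ _ X f hs hl hq hr hH => ?_⟩
  rcases CharP.char_is_prime_or_zero k p with hp | rfl
  · exact h p hp k X f hs hl hq hr hH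
  · exact cruxAt_zero k X f hs hl hq hr hH


/-! ## §3 The natural strengthening "a rung-2 local ring is already rung-3" is FALSE

The crux asks for a NEW model `X₂ → X`; the cheapest conceivable proof would take `X₂ := X₁`, i.e.
would show that a locally integral Cohen–Macaulay F-injective variety is already F-rational. This is
false already for CURVES over `𝔽_p`: the witness below is the complete local ring
`W_p = 𝔽_p + X·𝔽_{p²}⟦X⟧ = {f ∈ 𝔽_{p²}⟦X⟧ | f(0) ∈ 𝔽_p}` (for `p = 3` the completion of
`𝔽₃[x,y]/(x² + y²)` at the origin: an integral curve over `𝔽₃` whose closed point splits into a node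
over `𝔽₉`). It is a one-dimensional Noetherian local domain of characteristic `p` in which every
parameter ideal `(a)` is Frobenius closed (rung 2), but `(X)` is not tightly closed: `ωX ∉ (X)` while
`X · (ωX)^q ∈ (X^q)` for all `q = p^e` (`ω ∈ 𝔽_{p²} ∖ 𝔽_p`) — rung 3 fails (indeed `W_p` is not
normal: `ωX/X = ω` is integral). So the F-rational modification must MOVE (at least normalise), at
every prime `p`, even in dimension one.
-/

section LocalWitness

variable (p : ℕ) [Fact p.Prime]

/-- `𝔽_{p²}`. -/
abbrev 𝕃 : Type := GaloisField p 2

/-- The prime field `𝔽_p ⊆ 𝔽_{p²}` (image of `ZMod p`). -/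
abbrev primeRange : Subring (𝕃 p) := (algebraMap (ZMod p) (𝕃 p)).range

/-- An element of `𝔽_{p²}` fixed by Frobenius lies in the prime field (root count of `T^p - T`).
[folklore] -/
theorem mem_primeRange_of_pow_eq {x : 𝕃 p} (hx : x ^ p = x) : x ∈ primeRange p := by
  classical
  have hp : 1 < p := (Fact.out : p.Prime).one_lt
  by_contra hxn
  set f : Polynomial (𝕃 p) := Polynomial.X ^ p - Polynomial.X with hf
  have hf0 : f ≠ 0 := FiniteField.X_pow_card_sub_X_ne_zero (𝕃 p) hp
  have hdeg : f.natDegree = p := FiniteField.X_pow_card_sub_X_natDegree_eq (𝕃 p) hp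
  let S : Finset (𝕃 p) := insert x (Finset.univ.image (algebraMap (ZMod p) (𝕃 p)))
  have hS : S ⊆ f.roots.toFinset := by
    intro y hy
    rw [Multiset.mem_toFinset, Polynomial.mem_roots hf0, Polynomial.IsRoot, hf, Polynomial.eval_sub,
      Polynomial.eval_pow, Polynomial.eval_X, sub_eq_zero]
    rcases Finset.mem_insert.mp hy with rfl | hy
    · exact hx
    · obtain ⟨b, -, rfl⟩ := Finset.mem_image.mp hy
      rw [← map_pow, ZMod.pow_card]
  have hxS : x ∉ Finset.univ.image (algebraMap (ZMod p) (𝕃 p)) := by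
    intro hx'
    obtain ⟨b, -, hb⟩ := Finset.mem_image.mp hx'
    exact hxn ⟨b, hb⟩
  have hcardS : S.card = p + 1 := by
    rw [Finset.card_insert_of_notMem hxS,
      Finset.card_image_of_injective _ (algebraMap (ZMod p) (𝕃 p)).injective, Finset.card_univ,
      ZMod.card]
  have := (Finset.card_le_card hS).trans ((Multiset.toFinset_card_le _).trans (Polynomial.card_roots' f))
  rw [hcardS, hdeg] at this
  omega

/-- The prime field is Frobenius-saturated in `𝔽_{p²}`: `x^(p^e) ∈ 𝔽_p ⇒ x ∈ 𝔽_p`. [folklore] -/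
theorem mem_primeRange_of_pow_mem {x : 𝕃 p} (e : ℕ) (hx : x ^ p ^ e ∈ primeRange p) :
    x ∈ primeRange p := by
  apply mem_primeRange_of_pow_eq
  obtain ⟨b, hb⟩ := hx
  have h1 : (x ^ p ^ e) ^ p = x ^ p ^ e := by rw [← hb, ← map_pow, ZMod.pow_card]
  have h2 : (x ^ p - x) ^ p ^ e = 0 := by
    rw [sub_pow_char_pow, pow_right_comm, h1, sub_self]
  exact sub_eq_zero.mp ((pow_eq_zero_iff (pow_ne_zero e (Fact.out : p.Prime).ne_zero)).mp h2)

/-- `𝔽_{p²} ≠ 𝔽_p`. [folklore] -/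
theorem exists_not_mem_primeRange : ∃ ω : 𝕃 p, ω ∉ primeRange p := by
  by_contra h
  have h' : ∀ ω : 𝕃 p, ω ∈ primeRange p := fun ω => not_not.mp (not_exists.mp h ω)
  have hsurj : Function.Surjective (algebraMap (ZMod p) (𝕃 p)) := fun y => by
    obtain ⟨b, hb⟩ := h' y
    exact ⟨b, hb⟩
  have h1 := Nat.card_le_card_of_surjective _ hsurj
  rw [GaloisField.card p 2 two_ne_zero, Nat.card_zmod] at h1
  have hp := (Fact.out : p.Prime).two_le
  nlinarith

/-- THE WITNESS RING `W_p = {f ∈ 𝔽_{p²}⟦X⟧ | f(0) ∈ 𝔽_p}`. [folklore] -/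
def witt : Subring (PowerSeries (𝕃 p)) := (primeRange p).comap PowerSeries.constantCoeff

/-- The witness ring as a type. -/
abbrev Wit : Type := ↥(witt p)

theorem mem_witt {f : PowerSeries (𝕃 p)} :
    f ∈ witt p ↔ ∃ b : ZMod p, algebraMap (ZMod p) (𝕃 p) b = PowerSeries.constantCoeff f := by
  simp [witt, RingHom.mem_range]

theorem constantCoeff_map' {R S : Type} [CommRing R] [CommRing S] (g : R →+* S) (a : PowerSeries R) :
    PowerSeries.constantCoeff (PowerSeries.map g a) = g (PowerSeries.constantCoeff a) := by
  rw [← PowerSeries.coeff_zero_eq_constantCoeff_apply, PowerSeries.coeff_map,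
    PowerSeries.coeff_zero_eq_constantCoeff_apply]

/-- The uniformiser `X ∈ W_p`. -/
def xW : Wit p := ⟨PowerSeries.X, by rw [mem_witt]; exact ⟨0, by simp⟩⟩

@[simp] theorem coe_xW : ((xW p : Wit p) : PowerSeries (𝕃 p)) = PowerSeries.X := rfl

theorem xW_ne_zero : xW p ≠ 0 := fun h => PowerSeries.X_ne_zero (congrArg Subtype.val h)

/-- Units of `W_p` are the series with nonzero constant coefficient. [folklore] -/
theorem isUnit_iff_constantCoeff (a : Wit p) :
    IsUnit a ↔ PowerSeries.constantCoeff (a : PowerSeries (𝕃 p)) ≠ 0 := by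
  constructor
  · intro h h0
    have h1 := h.map (witt p).subtype
    rw [PowerSeries.isUnit_iff_constantCoeff] at h1
    exact h1.ne_zero h0
  · intro h
    have hu : IsUnit (a : PowerSeries (𝕃 p)) :=
      PowerSeries.isUnit_iff_constantCoeff.mpr (isUnit_iff_ne_zero.mpr h)
    obtain ⟨b, hb⟩ := (mem_witt p).mp a.2
    have hinv : (↑hu.unit⁻¹ : PowerSeries (𝕃 p)) ∈ witt p := by
      rw [mem_witt]
      refine ⟨b⁻¹, ?_⟩
      have h1 : PowerSeries.constantCoeff (a : PowerSeries (𝕃 p)) *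
          PowerSeries.constantCoeff (↑hu.unit⁻¹ : PowerSeries (𝕃 p)) = 1 := by
        rw [← map_mul, hu.mul_val_inv, map_one]
      rw [map_inv₀, hb]
      exact (eq_inv_of_mul_eq_one_right h1).symm
    exact isUnit_iff_exists_inv.mpr ⟨⟨_, hinv⟩, Subtype.ext hu.mul_val_inv⟩

theorem not_isUnit_xW : ¬ IsUnit (xW p) := by
  rw [isUnit_iff_constantCoeff]; simp

instance : IsLocalRing (Wit p) := by
  refine IsLocalRing.of_isUnit_or_isUnit_one_sub_self fun a => ?_
  by_cases h : PowerSeries.constantCoeff (a : PowerSeries (𝕃 p)) = 0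
  · right
    rw [isUnit_iff_constantCoeff]
    simp [h]
  · exact Or.inl ((isUnit_iff_constantCoeff p a).mpr h)

theorem mem_maximalIdeal_iff (a : Wit p) :
    a ∈ maximalIdeal (Wit p) ↔ PowerSeries.constantCoeff (a : PowerSeries (𝕃 p)) = 0 := by
  rw [IsLocalRing.mem_maximalIdeal, mem_nonunits_iff, isUnit_iff_constantCoeff, not_not]

instance : CharP (Wit p) p := by
  let φ : ZMod p →+* Wit p := (PowerSeries.C.comp (algebraMap (ZMod p) (𝕃 p))).codRestrict (witt p)
    (fun b => by rw [mem_witt]; exact ⟨b, by simp⟩)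
  exact charP_of_injective_ringHom φ.injective p

/-- `𝔽_{p²}⟦X⟧` is a finite `𝔽_p⟦X⟧`-module (coefficientwise expansion in a basis). [folklore] -/
theorem module_finite_powerSeries :
    Module.Finite (PowerSeries (ZMod p)) (PowerSeries (𝕃 p)) := by
  classical
  let b := Module.finBasis (ZMod p) (𝕃 p)
  refine ⟨⟨Finset.univ.image (fun i => PowerSeries.C (b i)), ?_⟩⟩
  rw [eq_top_iff]
  rintro f -
  set g : Fin (Module.finrank (ZMod p) (𝕃 p)) → PowerSeries (ZMod p) :=
    fun i => PowerSeries.mk fun m => b.repr (PowerSeries.coeff m f) i with hg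
  have hf : f = ∑ i, g i • PowerSeries.C (b i) := by
    ext m
    rw [map_sum]
    have key : ∀ i, PowerSeries.coeff m (g i • PowerSeries.C (b i)) =
        (b.repr (PowerSeries.coeff m f) i) • b i := fun i => by
      change PowerSeries.coeff m (PowerSeries.map (algebraMap (ZMod p) (𝕃 p)) (g i) *
        PowerSeries.C (b i)) = _
      rw [PowerSeries.coeff_mul_C, PowerSeries.coeff_map, hg, PowerSeries.coeff_mk, Algebra.smul_def]
    rw [Finset.sum_congr rfl fun i _ => key i, b.sum_repr]
  rw [hf]
  refine Submodule.sum_mem _ fun i _ => Submodule.smul_mem _ _ (Submodule.subset_span ?_)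
  simp

instance : IsNoetherianRing (Wit p) := by
  haveI := module_finite_powerSeries p
  let ψ : PowerSeries (ZMod p) →+* Wit p :=
    (algebraMap (PowerSeries (ZMod p)) (PowerSeries (𝕃 p))).codRestrict (witt p) (fun a => by
      rw [mem_witt]
      refine ⟨PowerSeries.constantCoeff a, ?_⟩
      change _ = PowerSeries.constantCoeff (PowerSeries.map (algebraMap (ZMod p) (𝕃 p)) a)
      rw [constantCoeff_map'])
  letI : Algebra (PowerSeries (ZMod p)) (Wit p) := ψ.toAlgebra
  let ι : Wit p →ₗ[PowerSeries (ZMod p)] PowerSeries (𝕃 p) :=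
    { toFun := fun w => (w : PowerSeries (𝕃 p))
      map_add' := fun _ _ => rfl
      map_smul' := fun _ _ => rfl }
  have hN : IsNoetherian (PowerSeries (ZMod p)) (Wit p) :=
    isNoetherian_of_injective ι Subtype.val_injective
  exact isNoetherian_of_tower (PowerSeries (ZMod p)) hN

theorem not_isField : ¬ IsField (Wit p) := fun h => by
  letI := h.toField
  exact not_isUnit_xW p (isUnit_iff_ne_zero.mpr (xW_ne_zero p))

/-- In `𝔽_{p²}⟦X⟧`: a nonzero series is `X^(ord) ·` unit. -/
theorem isUnit_divXPowOrder {a : PowerSeries (𝕃 p)} (ha : a ≠ 0) :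
    IsUnit (PowerSeries.divXPowOrder a) := by
  obtain ⟨n, hn⟩ : ∃ n : ℕ, a.order = n :=
    ⟨_, (ENat.coe_toNat (PowerSeries.order_eq_top.not.mpr ha)).symm⟩
  rw [PowerSeries.isUnit_iff_constantCoeff, PowerSeries.constantCoeff_divXPowOrder, isUnit_iff_ne_zero,
    hn, ENat.toNat_coe]
  exact (PowerSeries.order_eq_nat.mp hn).1

/-- The key estimate `𝔪 ⊆ rad (a)` for every `a ≠ 0`: a non-unit `g = X·g'` has
`g^(n+1) = a · (u⁻¹ X g'^(n+1))` where `a = Xⁿ u`. [folklore] -/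
theorem maximalIdeal_le_radical {a : Wit p} (ha : a ≠ 0) :
    maximalIdeal (Wit p) ≤ (Ideal.span {a}).radical := by
  intro g hg
  rw [mem_maximalIdeal_iff] at hg
  have ha' : (a : PowerSeries (𝕃 p)) ≠ 0 := fun h => ha (Subtype.ext h)
  set n := (a : PowerSeries (𝕃 p)).order.toNat with hn
  have hau : PowerSeries.X ^ n * PowerSeries.divXPowOrder (a : PowerSeries (𝕃 p)) =
      (a : PowerSeries (𝕃 p)) :=
    PowerSeries.X_pow_order_mul_divXPowOrder
  obtain ⟨u, hu⟩ := isUnit_divXPowOrder p ha'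
  obtain ⟨g', hg'⟩ := PowerSeries.X_dvd_iff.mpr hg
  rw [Ideal.mem_radical_iff]
  set ui : PowerSeries (𝕃 p) := ((u⁻¹ : (PowerSeries (𝕃 p))ˣ) : PowerSeries (𝕃 p)) with hui
  have huu : ui * (u : PowerSeries (𝕃 p)) = 1 := by rw [hui, Units.inv_mul]
  refine ⟨n + 1, Ideal.mem_span_singleton'.mpr ⟨⟨ui * PowerSeries.X * g' ^ (n + 1), ?_⟩, ?_⟩⟩
  · rw [mem_witt]; exact ⟨0, by simp⟩
  · apply Subtype.ext
    show (ui * PowerSeries.X * g' ^ (n + 1)) * (a : PowerSeries (𝕃 p)) =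
      (g : PowerSeries (𝕃 p)) ^ (n + 1)
    rw [hg', ← hau, ← hu, mul_pow, pow_succ]
    calc ui * PowerSeries.X * g' ^ (n + 1) * (PowerSeries.X ^ n * ↑u)
        = (ui * ↑u) * (PowerSeries.X ^ n * PowerSeries.X) * g' ^ (n + 1) := by ring
      _ = PowerSeries.X ^ n * PowerSeries.X * g' ^ (n + 1) := by rw [huu, one_mul]

/-- `dim W_p = 1`. [folklore] -/
theorem ringKrullDim_wit : ringKrullDim (Wit p) = 1 :=
  ringKrullDim_eq_one_iff_of_isLocalRing_isDomain.mpr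
    ⟨not_isField p, fun _ ha => maximalIdeal_le_radical p ha⟩

theorem radical_span_xW : (Ideal.span {xW p}).radical = maximalIdeal (Wit p) :=
  le_antisymm (IsLocalRing.le_maximalIdeal (by
    rw [Ne, Ideal.radical_eq_top, Ideal.span_singleton_eq_top]; exact not_isUnit_xW p))
    (maximalIdeal_le_radical p (xW_ne_zero p))

/-- In `𝔽_{p²}⟦X⟧`: `y^q = r a^q` with `a ≠ 0`, `q > 0` forces `a ∣ y` (compare orders). [folklore] -/
theorem dvd_of_pow_eq_mul_pow {a y r : PowerSeries (𝕃 p)} (ha : a ≠ 0) {q : ℕ} (hq : 0 < q)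
    (h : y ^ q = r * a ^ q) : a ∣ y := by
  by_cases hy : y = 0
  · exact hy ▸ dvd_zero a
  obtain ⟨na, hna⟩ : ∃ n : ℕ, a.order = n :=
    ⟨_, (ENat.coe_toNat (PowerSeries.order_eq_top.not.mpr ha)).symm⟩
  obtain ⟨ny, hny⟩ : ∃ n : ℕ, y.order = n :=
    ⟨_, (ENat.coe_toNat (PowerSeries.order_eq_top.not.mpr hy)).symm⟩
  have hle : na ≤ ny := by
    have h1 : (y ^ q).order = q • (ny : ℕ∞) := by rw [PowerSeries.order_pow, hny]
    have h2 : (y ^ q).order = r.order + q • (na : ℕ∞) := by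
      rw [h, PowerSeries.order_mul, PowerSeries.order_pow, hna]
    have h3 : q • (na : ℕ∞) ≤ q • (ny : ℕ∞) := by rw [← h1, h2]; exact le_add_self
    have h4 : ((q * na : ℕ) : ℕ∞) ≤ ((q * ny : ℕ) : ℕ∞) := by
      simpa [nsmul_eq_mul] using h3
    exact Nat.le_of_mul_le_mul_left (ENat.coe_le_coe.mp h4) hq
  have hXy : PowerSeries.X ^ na ∣ y := by
    have := PowerSeries.X_pow_order_dvd (φ := y)
    rw [hny, ENat.toNat_coe] at this
    exact (pow_dvd_pow _ hle).trans this
  have hau : PowerSeries.X ^ na * PowerSeries.divXPowOrder a = a := by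
    have := PowerSeries.X_pow_order_mul_divXPowOrder (f := a)
    rwa [hna, ENat.toNat_coe] at this
  obtain ⟨u, hu⟩ := isUnit_divXPowOrder p ha
  obtain ⟨y', hy'⟩ := hXy
  set ui : PowerSeries (𝕃 p) := ((u⁻¹ : (PowerSeries (𝕃 p))ˣ) : PowerSeries (𝕃 p)) with hui
  have huu : (u : PowerSeries (𝕃 p)) * ui = 1 := by rw [hui, Units.mul_inv]
  refine ⟨ui * y', ?_⟩
  rw [hy', ← hau, ← hu]
  calc PowerSeries.X ^ na * y' = PowerSeries.X ^ na * ((u : PowerSeries (𝕃 p)) * ui) * y' := by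
        rw [huu, mul_one]
    _ = PowerSeries.X ^ na * ↑u * (ui * y') := by ring

/-- RUNG 2 HOLDS IN `W_p`, principal part: every nonzero principal ideal `(a)` is Frobenius
closed. If `y^q = r a^q` then `a ∣ y` in `𝔽_{p²}⟦X⟧`, say `y = a b`, and `b^q = r ∈ W_p` forces
`b(0)^q ∈ 𝔽_p`, hence `b(0) ∈ 𝔽_p`, i.e. `b ∈ W_p`. [folklore] -/
theorem mem_span_of_pow_mem {a y : Wit p} (ha : a ≠ 0) (e : ℕ)
    (h : y ^ p ^ e ∈ Ideal.span ((fun z : Wit p => z ^ p ^ e) '' (Ideal.span {a} : Set (Wit p)))) :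
    y ∈ Ideal.span {a} := by
  have hq : 0 < p ^ e := pow_pos (Fact.out : p.Prime).pos e
  change y ^ p ^ e ∈ frobeniusPower (p ^ e) (Ideal.span {a}) at h
  rw [frobeniusPower_span, Set.image_singleton, Ideal.mem_span_singleton'] at h
  obtain ⟨r, hr⟩ := h
  have ha' : (a : PowerSeries (𝕃 p)) ≠ 0 := fun h => ha (Subtype.ext h)
  have hr' : (y : PowerSeries (𝕃 p)) ^ p ^ e = (r : PowerSeries (𝕃 p)) * (a : PowerSeries (𝕃 p)) ^ p ^ e := by
    have := congrArg Subtype.val hr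
    simpa using this.symm
  obtain ⟨b, hb⟩ := dvd_of_pow_eq_mul_pow p ha' hq hr'
  have hbq : b ^ p ^ e = r := by
    apply mul_left_cancel₀ (pow_ne_zero (p ^ e) ha')
    rw [← mul_pow, ← hb, hr', mul_comm]
  have hbW : b ∈ witt p := by
    rw [witt, Subring.mem_comap]
    apply mem_primeRange_of_pow_mem p e
    rw [← map_pow, hbq]
    exact r.2
  exact Ideal.mem_span_singleton'.mpr ⟨⟨b, hbW⟩, Subtype.ext (by simp [hb, mul_comm])⟩

/-- RUNG 2 HOLDS IN `W_p`: it is a domain, `dim = 1`, a system of parameters is one nonzero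
non-unit `a`, `[a]` is a regular sequence and `(a)` is Frobenius closed. [folklore] -/
theorem rungTwoAt_wit : RungTwoAt p (Wit p) := by
  refine ⟨inferInstance, fun d hd s hs => ?_⟩
  have hd1 : d = 1 := by
    have h := (ringKrullDim_wit p).symm.trans hd
    exact_mod_cast h.symm
  subst hd1
  have hrange : Set.range s = {s 0} := by rw [Set.range_unique]; rfl
  rw [hrange] at hs ⊢
  have ha : s 0 ≠ 0 := by
    intro h0
    rw [h0, Ideal.span_singleton_zero, Ideal.radical_bot_of_noZeroDivisors] at hs
    have hX : xW p ∈ maximalIdeal (Wit p) := (mem_maximalIdeal_iff p _).mpr (by simp)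
    rw [← IsLocalRing.eq_maximalIdeal hs, Ideal.mem_bot] at hX
    exact xW_ne_zero p hX
  refine ⟨?_, fun y ⟨e, hy⟩ => mem_span_of_pow_mem p ha e hy⟩
  have hofn : List.ofFn s = [s 0] := by simp [List.ofFn_succ]
  rw [hofn, RingTheory.Sequence.isWeaklyRegular_cons_iff]
  exact ⟨fun x y h => mul_left_cancel₀ ha h, RingTheory.Sequence.IsWeaklyRegular.nil _ _⟩

/-- RUNG 3 FAILS IN `W_p`: `(X)` is a parameter ideal, `ωX ∉ (X)` (`ω ∉ 𝔽_p`), yet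
`X · (ωX)^q = (ω^q X) · X^q ∈ (X)^[q]` for every `q = p^e` with `c = X ≠ 0`. [folklore] -/
theorem not_rungThreeAt_wit : ¬ RungThreeAt p (Wit p) := by
  rintro ⟨-, h⟩
  obtain ⟨ω, hω⟩ := exists_not_mem_primeRange p
  let y : Wit p := ⟨PowerSeries.C ω * PowerSeries.X, by rw [mem_witt]; exact ⟨0, by simp⟩⟩
  have hrange : Set.range (fun _ : Fin 1 => xW p) = {xW p} := Set.range_const
  have hs : (Ideal.span (Set.range fun _ : Fin 1 => xW p)).radical.IsMaximal := by
    rw [hrange, radical_span_xW]; exact maximalIdeal.isMaximal _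
  have key := h 1 (ringKrullDim_wit p) (fun _ => xW p) hs y (xW p) (xW_ne_zero p) ?_
  · rw [hrange, Ideal.mem_span_singleton'] at key
    obtain ⟨r, hr⟩ := key
    have hr' : (r : PowerSeries (𝕃 p)) * PowerSeries.X = PowerSeries.C ω * PowerSeries.X :=
      congrArg Subtype.val hr
    have hrC : (r : PowerSeries (𝕃 p)) = PowerSeries.C ω := mul_right_cancel₀ PowerSeries.X_ne_zero hr'
    apply hω
    obtain ⟨b, hb⟩ := (mem_witt p).mp r.2
    exact ⟨b, by rw [hb, hrC, PowerSeries.constantCoeff_C]⟩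
  · intro e
    rw [hrange]
    have hmem : xW p ^ p ^ e ∈ (fun z : Wit p => z ^ p ^ e) '' (Ideal.span {xW p} : Set (Wit p)) :=
      ⟨xW p, Ideal.subset_span rfl, rfl⟩
    let w : Wit p := ⟨PowerSeries.C (ω ^ p ^ e) * PowerSeries.X, by rw [mem_witt]; exact ⟨0, by simp⟩⟩
    have heq : xW p * y ^ p ^ e = w * xW p ^ p ^ e := by
      apply Subtype.ext
      show PowerSeries.X * (PowerSeries.C ω * PowerSeries.X) ^ p ^ e =
        PowerSeries.C (ω ^ p ^ e) * PowerSeries.X * PowerSeries.X ^ p ^ e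
      rw [map_pow]; ring
    rw [heq]
    exact Ideal.mul_mem_left _ _ (Ideal.subset_span hmem)

end LocalWitness

/-- NATURAL STRENGTHENING `LocalRungClimb` ("X₂ := X₁ works": every rung-2 Noetherian local ring
of prime characteristic is rung-3, i.e. CM + F-injective ⇒ F-rational). [folklore] -/
def LocalRungClimb : Prop :=
  ∀ p : ℕ, p.Prime → ∀ (R : Type) [CommRing R] [IsNoetherianRing R] [IsLocalRing R] [CharP R p],
    RungTwoAt p R → RungThreeAt p R

/-- At EVERY prime `p` there is a rung-2 Noetherian local ring of characteristic `p` (of dimension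
one) that is not rung-3: `W_p`. [folklore] -/
theorem exists_rungTwoAt_not_rungThreeAt (p : ℕ) (hp : p.Prime) :
    ∃ (R : Type) (_ : CommRing R) (_ : IsNoetherianRing R) (_ : IsLocalRing R) (_ : CharP R p),
      RungTwoAt p R ∧ ¬ RungThreeAt p R := by
  haveI : Fact p.Prime := ⟨hp⟩
  exact ⟨Wit p, inferInstance, inferInstance, inferInstance, inferInstance, rungTwoAt_wit p,
    not_rungThreeAt_wit p⟩

/-- `LocalRungClimb` IS FALSE (at every prime; instantiated at the given one). [folklore] -/
theorem localRungClimb_false_at (p : ℕ) (hp : p.Prime) :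
    ¬ (∀ (R : Type) [CommRing R] [IsNoetherianRing R] [IsLocalRing R] [CharP R p],
      RungTwoAt p R → RungThreeAt p R) := by
  intro h
  haveI : Fact p.Prime := ⟨hp⟩
  exact not_rungThreeAt_wit p (h (Wit p) (rungTwoAt_wit p))

/-- `LocalRungClimb` IS FALSE. [folklore] -/
theorem localRungClimb_false : ¬ LocalRungClimb := fun h =>
  localRungClimb_false_at 2 Nat.prime_two (h 2 Nat.prime_two)

end Summit.ResolutionOfSingularities.ResolutionOfSingularities.Cruxes.FRationalModification.Disproof
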